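import Mathlib
import HarnessLib
import HarnessLib.Audit
import Summits.QuantumFields.Statement
import Literature.MathematicalPhysics.QuantumLattice.LatticeGaugeDLR

/-!
Route: HyperbolicRegulator

DORMANT since 2026-09-05T00:14:43Z (reconciler: no traction for 5 d (last activity statement-checked at 2026-08-30T23:36:16Z); parked, not closed — `ledger route dormant route-QuantumFields-HyperbolicRegulator --off` to reactivate) — unstaffed, not closed; items shared with open routes are served there. `ledger route dormant <id> --off` reactivates.

# Route HyperbolicRegulator — curvature as infrared regulator — Wilson's theory on products of
subdivided hyperbolic square complexes, gapped at its own scale, uniform in the curvature scale,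
then flat tori (2001 AdS route)

It suffices to show X = CurvatureAnchorR ∧ CurvatureUniformityR ∧ HyperbolicToTorusR together with
the existence leg ContinuumLegGivenGap (unchanged; 2026-08-16 Statement: the witness scheme must
carry `HasWeakCouplingLimit`). REPAIRED 2026-08-17 (route-repair after
`Theorems.not_CurvatureAnchor`, class refuted-misstated): the three cruxes sharing the inlined `let
Fam` vocabulary were decided by an UNSATISFIABLE admissibility predicate — the flat threshold `k/4 <
dist x c` coincided with the sup-radius `(k:ℤ)/4` of the injective ℤ²-charts, so no complex is
admissible for k ≥ 208 (`NoAdmissibleComplex.no_admissible`); CurvatureAnchor (∃ family) was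
refuted, CurvatureUniformity and HyperbolicToTorus (∀ family) closed proved VACUOUSLY. The two
vacuously-proved decls stay in the file as settled edges (their landed proof files name them), the
refuted CurvatureAnchor is DROPPED from the route (rev 4 — the gate's condition for clearing BROKEN;
its record is the negatives index + the file comment, and
Theorems/HyperbolicRegulatorCurvatureAnchorRefutation.lean needs the standard migrate
re-declaration), and all three are superseded on the deciding chain by CurvatureAnchorR /
CurvatureUniformityR / HyperbolicToTorusR, which carry the LOCKSTEP repair every reviewer converged
on: (R-a) flat predicate `k/2 < dist x c`, deep predicate `3(k/4) < dist x c`, chart box radius k/4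
unchanged — a chart now has graph reach 2⌊k/4⌋ ≤ ⌊k/2⌋ and meets no cone (kernel-checked
`AdmR.chart_avoids_cones`, Cruxes/CurvatureAnchor/Disproof.lean; intended {4,5}_k patches
re-audited: every repaired-flat point charted for k = 8..20, flat/deep sets non-empty, clauses 5/6
tight but consistent); (R2) the clustering constant C (and the scale threshold K) are quantified
BEFORE the curvature scale k in CurvatureUniformityR's conclusion = HyperbolicToTorusR's hypothesis
(with C after k the bound was silent below scale k and the torus step had nothing to inherit); (I)
that conclusion is the INFRARED CORE, eventual in k (∀ A B ∃ C K ∀ k ≥ K …): `closes` consumes crux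
2 only through crux 4, which uses k → ∞ alone, so the per-scale onset band `∀ k ≥ 8` left the
deciding chain. RESURRECT-2001 of the earlier programme's `summits/ym/routes/ads-radius-continuity`
(STATUS proving, parked under FOCUS F1, never refereed: Thm A = Osterwalder–Schrader quantisation of
Yang–Mills on hyperbolic four-space H⁴_R along a geodesic with m(R) = Δ₁(R)/R, Thm B = flat-space
limit theorem under (H0)–(H3), a lattice arena with reflection positivity for every reflection of an
admissible complex, and the finding free ≠ wired on hyperbolic lattices; its crux 'linear growth of
the boundary gap Δ₁(R) ≥ cR' was never attacked), re-hosted so that `closes` reaches TODAY's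
Statement, which hard-codes Wilson's flat regularisation: the anti-de Sitter radius R becomes the
CURVATURE SCALE k of a square complex that is LOCALLY EXACTLY ℤ⁴. The regulated family is Wilson's
G-theory in the faithful representation r on X = S × S, S a finite square complex of type {4,5}_k —
every face a square, every vertex of degree 4 except 'cone' vertices of degree 5 (angle 5π/2)
forming a k-separated k-net, a uniform Poincaré (expander) inequality at scale k, and injective
ℤ²-charts of sup-radius k/4 at every FLAT point (farther than k/2 from every cone), so X is a flat
ℤ⁴ box of radius k/4 around every pair of flat points, with all six plaquette orientations realised
by the three square sorts face×vertex, vertex×face, edge×edge and ONE coupling β. CurvatureAnchorR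
(construction + anchor): such families exist for every k ≥ 8 with separations of DEEP points
(farther than 3(k/4) from every cone) exhausting j → ∞ (k-subdivided covers of the {4,5} map on
Bring's surface with girth → ∞ and spectral gap bounded below — conditioned-random or congruence
covers) AND for β ≥ β₀(k) all pairs of chart-read gauge-invariant local observables (support radius
≤ k/8) at flat base points cluster at rate c/k in the intrinsic distance, uniformly in j ≥ j₀: the
hyperbolic femto-universe — weak coupling at all scales below k, an infrared mass ≍ 1/k from
expansion, no boundary, no flux sector, no zero mode at the working scale. CurvatureUniformityR (THE
crux, infrared core): for every admissible family with the anchor there is β₁ such that at every β ≥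
β₁ ONE rate m(β) > 0 clusters, for each pair of observables with ONE constant C(A,B,β), ALL
curvature scales k ≥ K(A,B,β). HyperbolicToTorusR: such a k-uniformly clustering admissible family
yields the symmetric-torus weak-coupling gap UniformLatticeGap (target, shared verbatim with
ConvexGribovBody / ContractibleFibre / SmallCircleAnchor). No idea card is realised (novel-route
lens resurrect-2001).
Lean: `CurvatureAnchorR ∧ CurvatureUniformityR ∧ HyperbolicToTorusR ∧ ContinuumLegGivenGap`

## Assembly
Pure logic (theorem `closes`, sorry-free, axioms propext / Classical.choice / Quot.sound, lean check
rc 0 on the repair Sketch): fix a compact simple G with its instances; ContinuumLegGivenGap reduces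
`YangMills` for G to the UniformLatticeGap body for every faithful r under the Statement's own `letI
:= borel G`; for such r, CurvatureAnchorR yields the family data (V, E, Q, σ, τ, bd, cV, cE), its
admissibility and the anchor conclusion; CurvatureUniformityR applied to that data gives the
k-uniform rate with k-uniform constants; HyperbolicToTorusR applied to the same data gives the body.
The repaired `let Fam := …` vocabulary of the three R-cruxes is byte-identical and the conclusion of
crux 2 is verbatim the clustering hypothesis of crux 4, so the composition is `obtain
⟨V,E,Q,σ,τ,bd,cV,cE,hAdm,hAnch⟩ := h₁ G hG r; exact h₃ G hG r … hAdm (h₂ G hG r … hAdm hAnch)`.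
UniformLatticeGap (target) and the two kept pre-repair decls are not hypotheses of `closes`; the
item `Assembly` is restated (rev 4) to `CurvatureAnchorR → CurvatureUniformityR → HyperbolicToTorusR
→ ContinuumLegGivenGap → YangMills`, literally the type of `closes` (its pre-repair form named the
dropped decl and was ex-falso-true).

Rationale: WHY THIS LINE. Negative curvature is the one infrared regulator of four-dimensional Yang–Mills that
is simultaneously gauge-invariant, isotropic, boundary-free and sector-free: on H⁴_R (or H²×H²) the
transverse vector Laplacian has bottom of spectrum ≍ 1/R², so for RΛ ≪ 1 the theory is weakly
coupled at EVERY scale (Callan–Wilczek doi:10.1016/0550-3213(90)90451-I;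
Aharony–Berkooz–Tong–Yankielowicz arXiv:1210.5195), and the hep-th programme 'AdS radius as a dial
from weak coupling to flat space' explicitly proposes this interpolation as a way to the mass gap
(Copetti–Di Pietro–Ji–Komatsu arXiv:2312.09277; Ciccone–De Cesare–Di Pietro–Serone arXiv:2407.06268)
— the 2001 route formalised its two soft ends (OS quantisation on H⁴_R, flat-space limit) and
stopped. What is imported here, and what the 2001 route lacked, is an object from geometric group
theory / spectral geometry that makes the dial WILSON-NATIVE: the k-fold subdivision of the {4,5}
square tiling (Davis complex of the right-angled pentagon group; finite quotients = square-tiled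
covers of Bring's surface, W. Weber 2005) is flat ℤ² off a k-net of cone points, its finite covers
form uniform expanders with girth → ∞ (Magee–Naud–Puder arXiv:2003.10911, Hide–Magee
arXiv:2107.05292; congruence covers of the arithmetic (2,4,5) group), and the product S × S of two
such factors gaps the gauge field at scale k (a factorwise-harmonic one-form still pays the spectral
gap of the other factor — the reason a single hyperbolic factor times ℤ² would NOT do), carries
Wilson's action verbatim with reflection positivity across the pentagon-group walls (2001 lattice
arena) and has flat Wilson–DLR conditional laws inside every chart. So the anchor is a
Bałaban-mechanical weak-coupling statement WITHOUT the toron/zero-mode problem of the femto-torus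
(the complex is contractible in the limit, and finite approximants are used only at girth ≫ k, i.e.
in the thermodynamic regime of the REGULATED theory whatever β is), the continuity parameter is a
curvature scale rather than a box side, a deformation strength or a fibre width, and
decompactification is automatic: local limits k → ∞ are flat Wilson Gibbs states. Prior routes
regulate by free faces (ContractibleFibre: wall states, two free 3-faces), by a double-trace
deformation on a thermal circle (SmallCircleAnchor: an unphysical path to undo), by 't Hooft flux
(FluxBootstrap / MarginalTwistOnset, and the closed twisted-tube card: flux sectors and tunnelling
rates); none uses curvature, expansion or a non-amenable complex, and the negatives index (4
entries, QCD block systems and diagonal-mirror RP) is untouched. (Repair 2026-08-17: the typed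
admissibility class had flat threshold = chart radius and was empty for k ≥ 208 — a typing slip, not
an objection to the line; the repaired class 'finite square surfaces locally modelled on ℤ² up to
sup-radius k/4 at every point farther than k/2 from the k-net of cones, expander at scale k' is the
one this paragraph describes; its intended members were re-audited against the exact {4,5}_k model.)

RANKED CRUXES. #0 UniformLatticeGap (target) — for every compact simple Lie group G and faithful
unitary lattice representation r there is β₀ with: for all β ≥ β₀ there are m > 0 and S₁ such that
all pairs of gauge-invariant local observables A, B satisfy |⟨A·τ_n B⟩ − ⟨A⟩⟨B⟩| ≤ C(A,B) e^(−m n)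
on every torus (2S+1)⁴, S ≥ S₁, n ≤ S, under Wilson's measure at β (shared verbatim with
ConvexGribovBody / ContractibleFibre / SmallCircleAnchor, stmt-QuantumFields-8778). (why it might
fail: It is the weak-coupling lattice mass gap (Chatterjee Problem 5.1 first half); nothing is
proved for non-abelian G in d = 4 beyond strong coupling; a massless phase at some large β refutes
it.) [arXiv:1803.01950, JaffeWitten2000, OsterwalderSeiler1978]
SHARED VOCABULARY of cruxes 2–4 (the repaired `let Fam`, byte-identical in the three decls): an
admissible hyperbolic family is, for every k ≥ 8 and every j, a finite square complex S_(k,j) ⊂ ℕ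
with oriented edges and squares (every edge two distinct endpoints; every square four boundary edges
closing up with four distinct corners; every edge in exactly two squares), vertex degrees 4 or 5
with #squares at a vertex = its degree, degree-5 cones pairwise ≥ k apart and k-dense, the Poincaré
inequality Σf² ≤ 10⁶k²·Σ_E(∇f)² for mean-zero f, two DEEP points (graph distance > 3(k/4) to every
cone) at distance ≥ j, and at every FLAT point (graph distance > k/2 to every cone) an injective
chart of the ℤ² sup-box of radius k/4 centred there, matching vertices, oriented edges and unit
squares (graph reach 2⌊k/4⌋ ≤ ⌊k/2⌋: no chart meets a cone — `AdmR.chart_avoids_cones`); the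
clustering predicate at (β, m, C, A, B) says: for all flat base points (x,x'), (y,y') of S×S the
Wilson expectation (product Haar on the edges (E×V) ⊔ (V×E) of the product complex, weight exp(β Σ
Re tr r(hol)) over the three square sorts) satisfies |E[A_(x,x') B_(y,y')] − E[A_(x,x')]E[B_(y,y')]|
≤ C exp(−m(dist(x,y)+dist(x',y'))), A_(x,x') the chart-read copy of the YMSpecies A (support radius
≤ k/8, so it reads chart edges only).
#2 CurvatureUniformityR (crux) — (THE CRUX — uniformity in the curvature scale; the 2001 crux 'Δ₁(R)
≥ cR' in lattice clothes, typed as its INFRARED CORE) for every compact simple G, faithful unitary r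
and EVERY admissible hyperbolic family: IF the anchor conclusion holds (one c > 0 for all k ≥ 8 and
thresholds β₀(k), with clustering at rate c/k for all A, B of support radius ≤ k/8, constants C and
j ≥ j₀ depending on (k, β, A, B)), THEN there is β₁ such that for every β ≥ β₁ ONE rate m(β) > 0
serves: for all A, B there are ONE constant C and a scale threshold K such that for ALL k ≥ K (with
supports inside radius k/8) and j ≥ j₀(β,k,A,B) the clustering bound holds at rate m with constant
C. [deps: CurvatureAnchorR] [difficulty: open-problem] (why it might fail: It contains the
weak-coupling volume-uniform gap (flat regions of radius k/4 → ∞ must cluster at a k-independent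
rate with k-uniform constants); FALSE for U(1) (expander photon mass ≍ 1/k → 0), so asymptotic
freedom must enter; free ≠ wired hyperbolic states (2001 finding) could carry slow boundary-like
modes at large β.) [arXiv:1210.5195, arXiv:2312.09277, arXiv:2407.06268, arXiv:1803.01950,
doi:10.1016/0550-3213(90)90451-I]
#3 CurvatureAnchorR (crux) — (CONSTRUCTION + ANCHOR, the 2001 'small radius: weak coupling at every
scale' step made a theorem target; C′ of `not_CurvatureAnchor`) for every compact simple G and
faithful unitary r THERE IS an admissible hyperbolic family (data V,E,Q ⊂ ℕ, src, tgt, oriented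
square boundaries, vertex and edge charts, indexed by k and j, admissible for all k ≥ 8 and all j)
and ONE c > 0 such that for every k ≥ 8 there is β₀(k) with: for β ≥ β₀(k) and all A, B of support
radius ≤ k/8 there are C and j₀ such that for j ≥ j₀ the clustering predicate holds at rate c/k.
Intended: k-subdivided expander covers of the {4,5} map on Bring's surface with girth → ∞ (a CHOICE,
not a w.h.p. property: congruence towers or random covers conditioned on the positive-probability
large-systole event); finitely many (≍ log k) Bałaban steps at couplings → 0, then a single-scale
cluster expansion around the expansion-gapped Gaussian at scale k (Künneth gap ≥ 10⁻⁷/k² of the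
1-form Hodge Laplacian on S×S, checked by hand on the item), torons suppressed by e^(−girth/(Ck)).
Registered lines (giant_beta_gjs, birth) re-register verbatim with the repaired Adm. [difficulty:
XL] (why it might fail: Torons of the finite approximants (b₁ = 4g_j flat directions) may put a
j-dependent floor under chart-read covariances at fixed (k, β); expander + large-girth
square-complex towers and ≍ log k Bałaban steps on a curved complex are unprinted (RG-I Thm 2,
PERT-2 gaps).) [arXiv:2003.10911, arXiv:2107.05292, arXiv:2003.05892, Balaban1989,
OsterwalderSeiler1978, arXiv:1210.5195, Summit.QuantumFields.YangMills.Theorems.not_CurvatureAnchor]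
#4 HyperbolicToTorusR (crux) — (HYPERBOLIC FAMILY ⇒ SYMMETRIC TORUS) for every compact simple G,
faithful unitary r and every admissible hyperbolic family: IF one rate m(β) > 0 clusters the family
with k-uniform constants for all large k at every β ≥ β₁ (VERBATIM the conclusion of
CurvatureUniformityR), THEN the UniformLatticeGap body holds for r (β₀; for β ≥ β₀ a rate m > 0 and
S₁ with |latticeConnectedCorr r.ρ β (2S+1) A.F B.F n| ≤ C(A,B) e^(−m n) for all YMSpecies A, B, S ≥
S₁, n ≤ S). Intended proof: the deep flat balls of radius k/4 carry Wilson–DLR conditional laws, so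
k → ∞ (j ≥ j₀) chart-local limits are translation-covariant flat Gibbs states of Wilson's
specification at β clustering at rate m with the INHERITED constants C(A,B) (charts at different
base points differ by hypercubic motions, which permute YMSpecies); identify them with
periodic-torus states on gauge-invariant local observables and transfer to latticeConnectedCorr on
(2S+1)⁴ with S-uniform constants — recommended re-cut (strategist census): end the torus leg in
MeanBoxInfluenceDecayAt and discharge it by the LANDED `clustering_of_meanBoxInfluenceDecay_at`
(vacuum-dominance labour disappears, the identification core stays); alternative finite-window
lever: odd-torus RP log-convexity at the half period (crux idea antipodal-washout). [deps:
CurvatureUniformityR] [difficulty: L] (why it might fail: Chart-local limits of hyperbolic states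
need not be the torus-limit phase at weak coupling (ℤ⁴ DLR uniqueness at large β is open; 2001 found
free ≠ wired on hyperbolic lattices); S-uniform torus constants need a torus-law influence bound,
not just a clustering state.) [OsterwalderSeiler1978, Seiler1982, arXiv:1803.01950,
arXiv:2006.16229, doi:10.1007/BF01011153]
#5 ContinuumLegGivenGap (crux, unchanged) — (existence leg, RE-TYPED for the 2026-08-16 Statement)
for every compact simple Lie group G: IF for every faithful unitary r the volume-uniform
weak-coupling lattice gap holds (UniformLatticeGap body for G, Borel σ-algebra), THEN there are r, a
sequential scheme sch WITH β_k → ∞ (`sch.HasWeakCouplingLimit`) and OS data T with IsYangMillsFor r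
sch T, T non-trivial and non-Gaussian in tr F², and Δ > 0 with T.HasMassGap Δ ∧ HasLatticeMassGap r
sch Δ. Intended use: a_k ∝ m(β_k) with β_k → ∞, joint continuum limit with E0–E4 at that scale
(Bałaban UV control, E1 by any rotation route of the hub), non-triviality from the curvature
three/four-point function. [deps: UniformLatticeGap] [difficulty: open-problem] (why it might fail:
Contains the joint continuum limit of all gauge-invariant fields with O(4) invariance (E1) and
non-Gaussianity of tr F², both open; a lattice gap m(β)→0 gives a continuum gap only if 1/m(β_k) is
THE correlation length of every species, with constants uniform in k.) [JaffeWitten2000,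
Balaban1989, arXiv:1803.01950, OsterwalderSeiler1978,
Literature.Barriers.QuantumFields.UVStabilityNonUniqueness]
SETTLED PRE-REPAIR EDGES (not on the deciding chain): CurvatureUniformity (stmt-15825, proved
vacuously by `curvatureUniformity_proof`) and HyperbolicToTorus (stmt-15827, proved vacuously by
`hyperbolicToTorus_proof`) are KEPT in the file; CurvatureAnchor (stmt-15826, refuted by
`not_CurvatureAnchor`) is DROPPED (rev 4, to clear BROKEN; record = negatives index + file comment)
— all three through `NoAdmissibleComplex.no_admissible`; the Disproof.lean files and Negative lemmas
record the slip.

TWO-LAYER PLAN. Foreseen glued splits (nothing filed now): CurvatureAnchorR ⇐ ExpanderSquareTowers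
(pure combinatorics/spectral geometry: k-subdivided {4,5}-covers of Bring's surface with girth → ∞
and Poincaré constant ≤ 10⁶k², repaired charts — the registered stub_towers) →
RegulatedWeakCouplingExpansion (β ≥ β₀(k): ≍ log₂k Bałaban steps + one-scale cluster expansion about
the Künneth-gapped Gaussian, torons at girth ≫ k — stub_kunneth + stub_gjs) → CurvatureAnchorR.
CurvatureUniformityR ⇐ LogQuantAnchor (the anchor with an explicit threshold β₀(k) = B log k + C,
what ≍ log k Bałaban steps output) → BeyondCrossover (k ≥ k*(β) = exp((β−C)/B): the honest infrared
core, induction in k from the crossover scale at FIXED β) → CurvatureUniformityR (crux idea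
log-anchor-absorbs-onset; the pre-repair window/onset layer 'CurvatureWindow → CurvatureBeyondWindow
over ∀ k ≥ 8' is retired with the O-band). HyperbolicToTorusR ⇐ LocalLimitsAreWilsonGibbs
(chart-local limits with inherited constants) → TorusIdentification (⇒ MeanBoxInfluenceDecayAt, then
the landed torus leg) → HyperbolicToTorusR.

KILL CRITERIA. Refutation of CurvatureUniformityR for some compact simple G (an admissible family
satisfying the anchor whose best eventual rate provably tends to 0 along k → ∞ at arbitrarily large
β — e.g. boundary-type slow modes of a wired hyperbolic state surviving in the flat balls) closes
the route `refuted:CurvatureUniformityR`; there is no pivot inside this line. Refutation of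
CurvatureAnchorR splits: (i) no admissible family exists under the REPAIRED axioms (a second
combinatorial slip — the first, flat threshold = chart radius, is what broke the route on 2026-08-17
and was repaired by R-a; the repaired class was re-audited on the exact model, so a recurrence means
a new slip introduced by the restate: repair again by adding the corrected statement), (ii) families
exist but the c/k anchor fails at fixed k for all β₀ (torons of the finite approximants do not
decouple: a j-uniform covariance floor) — pivot to an anchor stated on the infinite complex via DLR
states, or close. Refutation of HyperbolicToTorusR needs ¬UniformLatticeGap (the conclusion ignores
the family: `UniformLatticeGap → HyperbolicToTorusR`), i.e. it is summit-negation; a provability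
failure (hyperbolic-limit and torus states differ on local observables at weak coupling) kills the
presentation only — pivot to a torus clause via the 2001 ergodic passage with vortex dominance as an
extra crux. UniformLatticeGap proved by ANY route moots cruxes 2–4; LatticeMassGapAllCouplings
likewise. The Statement re-type of 2026-08-16 (HasWeakCouplingLimit) is absorbed in crux 5.

NOT DECOMPOSED YET. The crossover split of CurvatureUniformityR (Two-layer plan) is earned when
CurvatureAnchorR closes. Deliberately NOT folded into this repair (recorded for the tenure planner;
each would change the binder lists of all three Fam decls and needs its own audit): (R-b) CONE
CHARTS — an injective 5-quadrant chart of radius k/2 onto the ball B(c, k/2) at every degree-5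
vertex (standardises the near-cone islands, where the axioms as typed still allow pinched vertices /
pillowcases; wanted if a proof of crux 2 needs local control near cones; consistent with the
intended model, Cruxes/CurvatureUniformity/StrategistSketch.lean `ConeChartClause`); (R-c)
DISC/SYSTOLE CLAUSE — χ(closed graph ball of radius ≤ j/2) = 1 (makes j an injectivity-radius index
and switches off flat bands of bounded length; verified χ = 1 on > 4000 balls of the exact {4,5}_k
model, CHI-BALLS.md; not needed on the deciding chain once crux 2 is typed eventual-in-k: a band of
circumference < k/2 through a flat point is already excluded by chart injectivity, and longer bands
have temperature → 0 at fixed β as k → ∞); (Sub₃ᵃ) re-cut of HyperbolicToTorusR into 'clustering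
chart-local DLR state ⇒ MeanBoxInfluenceDecayAt' + the landed torus leg, with k-uniformisation and
the local-limit extraction as supports; (W) typing the torus conclusion as HalfPeriodDecay
(equivalent to the torus clause by the not-yet-landed WashoutLemma). Constants are generous
placeholders, not optimised: Poincaré constant 10⁶k² (true value ≍ 25k² for 3/16-expanding covers),
chart radius k/4, flat threshold k/2, deep threshold 3(k/4), support radius k/8, cone density k,
floor k ≥ 8. No definition item is filed: the square-complex vocabulary is inlined as the one
repaired `let Fam := …` (a pair: admissibility, clustering) exactly as ContractibleFibre /
SmallCircleAnchor inline theirs; the disprovers' named copies (`NoAdmissibleComplex.Adm`,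
`Disproof.AdmR`, `FamClust`, `Sp`, `TorusGap`) agree with the inlined text by ζδ-unfolding and a
named `Literature/MathematicalPhysics/QuantumLattice/SquareComplexGauge.lean` is a later
convenience. Reflection positivity across the pentagon-group walls and the transfer operator along
wall-translations (2001 Thm A's lattice analogue) are prover tools, deliberately not items.
Non-triviality/OS/continuum sit entirely inside ContinuumLegGivenGap.

CHEAPEST FALSIFIER. (0) Typing (done for this repair; re-armed refuters re-run it on the rendered
text): vacuity/junk audit of the repaired Fam — chart reach 2⌊k/4⌋ ≤ ⌊k/2⌋ < flat distance, ⌊k/2⌋ ≤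
3⌊k/4⌋ < k, ⌊k/8⌋ + 1 ≤ ⌊k/4⌋, all by omega (`repair_arith` etc.); intended patches charted for k =
8..20 (repair_check.py); flat/deep sets non-empty, clauses 5/6 consistent at equality
(CHI-BALLS.md). (1) Free-field level (by hand, passes): on S × S the coexact 1-form Laplacian is
bounded below by ≍ 1/k², because a harmonic 1-form on one factor tensored with a function on the
other still pays λ₁ of the other factor — whereas S × ℤ² or ℤ³ × (tree) is GAPLESS (h ⊗ slowly
varying f): the product of TWO hyperbolic factors is forced. Hence U(1) on S × S has photon mass ≍
1/k: CurvatureAnchorR plausible for U(1), CurvatureUniformityR false for U(1) — the abelian test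
bites exactly at crux 2. (2) Combinatorial existence (lookup): the regular map {5,4} on Bring's
surface (genus 4; 24 pentagons, 30 vertices, 60 edges, rotation group S₅) dualises to a {4,5} square
complex with 24 degree-5 vertices and 30 squares; k-subdivision and large-girth covers meet the
degree/cone/chart axioms by inspection; expansion of covers: arXiv:2003.10911. (3) Kit test: SU(2)
heat-bath on S_(k,j) × S_(k,j), k = 8, 12, 16, β = 2.3–2.6: the plaquette correlation length in flat
balls must scale like k below ≈ 3ξ(β) and SATURATE at the flat value above (linear growth past 3ξ =
wired/boundary modes, endangers crux 2); at fixed (k, β) two cover degrees test the toron floor of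
crux 3.

NUMBERS. {4,5} tiling: squares with 5 at a vertex, cone angle 5π/2 (curvature −π/2 per big vertex);
after k-subdivision cones are exactly k apart along big edges and every vertex is within graph
distance k of a cone. Bring's surface: genus 4, regular maps {5,4}/{4,5} with 24/30 faces, |Aut⁺| =
120. Spectral input: random degree-n covers of a closed hyperbolic surface have relative spectral
gap ≥ 3/16 − ε w.h.p. (arXiv:2003.10911), near 1/4 (arXiv:2107.05292); graph Poincaré constant of
the k-subdivided cover ≍ (4/λ₁s²)k² ≈ 25k² for λ₁ = 3/16, side s ≈ 1.25 — the axiom allows 10⁶k².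
Repaired thresholds (ℕ-division): chart sup-radius ⌊k/4⌋, graph reach 2⌊k/4⌋ ≤ ⌊k/2⌋; flat = dist >
⌊k/2⌋; deep = dist > 3⌊k/4⌋ (< k − 1, so big-square centres are deep for every k ≥ 8); support
radius ⌊k/8⌋, ⌊k/8⌋ + 1 ≤ ⌊k/4⌋; the pre-repair slip bit from k = 12 (interior chart cone) and k =
208 (landed shell count). Continuum dictionary: bottom of the 1-form spectrum on H⁴_R is 1/(4R²) (no
L² harmonic 1-forms), on H²×H² it is λ₀(functions on H²) = 1/(4R²); AdS₄ Yang–Mills is weakly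
coupled for RΛ ≲ 1 and must confine for RΛ ≫ 1 (arXiv:1210.5195; boundary-operator merger scenario
arXiv:2407.06268). Flat target scale: ξ(β) ≍ exp(3π²β/11)·β^(−51/121) (SU(2), two-loop), so 'k ≥
εξ(β)' is the beyond-window regime.

DEFINITION REQUESTS. None at open (vocabulary inlined). Cite facts wanted later (ledger workitem add
--kind cite): 'random covers of a closed hyperbolic surface are uniform expanders'
(Magee–Naud–Puder, GAFA 2022, arXiv:2003.10911, Thm 1.1); 'Bring's surface carries the regular map
{5,4}₆' (W. Weber, Pacific J. Math. 220 (2005) 167); arXiv:1210.5195 §2 (physics-level, record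
only).

Novelty: Searches (2026-08-16): `lit search --source arxiv "lattice gauge theory hyperbolic lattice
tessellation"` (2: arXiv:2309.03857 Shankar–Maciejko 'Hyperbolic lattices and two-dimensional
Yang–Mills theory' PRL 133 (2024); arXiv:2506.02113 Ising on hyperbolic space); `lit search --source
arxiv "confinement anti-de Sitter space gauge theory"` (15: arXiv:1210.5195, hep-th/9803131,
arXiv:2407.06268, arXiv:2312.09277 'Taming Mass Gap with Anti-de-Sitter Space', hep-th/9807205 …);
`lit read arxiv:2312.09277 --pages 1-3` (abstract/intro read: 'AdS acts as an infra-red cut off for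
asymptotically free theories … Understanding the transition could aid in proving the mass gap
applying conformal bootstrap'); `lit search --hybrid "lattice gauge theory on hyperbolic lattice
negative curvature"` (10 book hits, none relevant: Montvay–Münster, Altland–Simons, Makeenko); `lit
galaxy search "gauge theory on hyperbolic lattice" --star all` (0/0/0), `--star pdf "hyperbolic
lattice"` (20, none on gauge theory: percolation beyond ℤ^d, hyperbolic band theory); OpenAlex/S2
rate-limited (429) today; grep of all 23 Theses and 77 Ideas of this sub for hyperbolic / AdS /
expander / non-amenable / Coxeter (hits only in the PDE sense and the 2001 note inside
ContractibleFibre); the 2001 archive itself (summits/ym/routes/ads-radius-continuity: brief, CENSUS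
A1–A6/B1, unrefereed).
Nearest prior art found: arXiv:1210.5195 and arXiv:2312.09277 / arXiv:2407.06268 (continuum AdS
radius as IR regulator and weak-to-  [refs: 2309.03857, 2506.02113, 1210.5195, 2407.06268, 2312.09277, arxiv:2312.09277]

Barriers (technique_class: hyperbolic-regulator, expander-complex, anchor): - technique_class: hyperbolic-regulator, expander-complex, anchor
- Literature.Barriers.QuantumFields.FiniteTemperatureDeconfinement: evaded by construction — there
is NO compact direction and no Polyakov loop at any stage (the complex is contractible in the limit;
finite approximants are used only at girth ≫ k, where non-contractible holonomies are exponentially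
decoupled from local observables), so the Borgs–Seiler order parameter does not exist in the family.
- Literature.Barriers.QuantumFields.EguchiKawaiBreakdown: evaded — no reduction to a small periodic
volume; the small parameter is 1/(kΛ_lat) of an INFINITE-volume-like (expander) geometry, and centre
symmetry is never invoked.
- Literature.Barriers.QuantumFields.AbelianDeconfinementD4: it does not evade it by technique —
CurvatureUniformity is FALSE for U(1) (the expander photon mass ≍ 1/k vanishes with the curvature),
while CurvatureAnchor and HyperbolicToTorus are group-blind; the bet is that asymptotic freedom
enters visibly and only at crux 2, where the regulated correlation length k must be overtaken by the
dynamical one.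
- Literature.Barriers.QuantumFields.PerturbativeInvisibility: respected — only the anchor rate c/k
(an expansion/curvature threshold) is perturbatively visible; the k-uniform rate m(β) of crux 2 is
not claimed from any series in g.
- Literature.Barriers.QuantumFields.UVStabilityNonUniqueness: confined to crux 5 (the shared
existence leg) and to the finitely many Bałaban steps of the anchor at F

History (route lifecycle, newest last):
- 2026-08-17T12:49:08Z · BROKEN — CurvatureAnchor (stmt-QuantumFields-15826, crux) refuted by Summit.QuantumFields.YangMills.Theorems.not_CurvatureAnchor @ 896f1b2d098f (prover-line-stmt-QuantumFields-15826-0)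
- 2026-08-17T13:28:19Z · rev 4: restated Assembly (stmt-QuantumFields-15829) — repair 2/2: DROP the refuted CurvatureAnchor (stmt-QuantumFields-15826, refuted-misstated by Theorems.not_CurvatureAnchor) — it is superseded on the deciding ch (planner-rfix-QuantumFields-HyperbolicRegulat-7847a2fe-0)
- 2026-08-17T13:28:19Z · rev 4: dropped CurvatureAnchor — repair 2/2: DROP the refuted CurvatureAnchor (stmt-QuantumFields-15826, refuted-misstated by Theorems.not_CurvatureAnchor) — it is superseded on the deciding ch (planner-rfix-QuantumFields-HyperbolicRegulat-7847a2fe-0)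
- 2026-08-17T13:28:19Z · REPAIRED (restate Assembly; drop CurvatureAnchor) — back to open: repair 2/2: DROP the refuted CurvatureAnchor (stmt-QuantumFields-15826, refuted-misstated by Theorems.not_CurvatureAnchor) — it is superseded on the deciding ch (planner-rfix-QuantumFields-HyperbolicRegulat-7847a2fe-0)
- 2026-08-26T14:58:01Z · DORMANT — reconciler: no traction for 6.7 d (last activity item-proof-filed at 2026-08-19T22:25:47Z); parked, not closed — `ledger route dormant route-QuantumFields-Hyper (operator:999:3658904)
- 2026-08-28T21:18:30Z · REACTIVATED — reconciler: reactivated — activity statement-closed at 2026-08-28T18:49:18Z after parking at 2026-08-26T14:58:01Z (operator:999:2570758)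
- 2026-09-05T00:14:43Z · DORMANT — reconciler: no traction for 5 d (last activity statement-checked at 2026-08-30T23:36:16Z); parked, not closed — `ledger route dormant route-QuantumFields-Hyperb (operator:999:546309)

sub-problem: YangMills · status: dormant · opened operator:999:3776189 2026-08-16T17:33:25Z · rev 5 · ledger route-QuantumFields-HyperbolicRegulator
GENERATED by the gate from the ledger (D-0016/17). Provers cite these decls: `theorem foo : Summit.QuantumFields.YangMills.Theses.HyperbolicRegulator.<Decl> := …` in Summits/QuantumFields/YangMills/Theorems/<Name>.lean.
-/

namespace Summit.QuantumFields.YangMills.Theses.HyperbolicRegulator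

open scoped BigOperators Topology Manifold Classical MeasureTheory ProbabilityTheory Matrix InnerProductSpace ComplexConjugate ContinuousMap
open Filter Set Function TopologicalSpace MeasureTheory

attribute [summit_statement] _root_.YangMills

/-- item stmt-QuantumFields-8778 · target · rank 0 · open · by planner
why it might fail: It is the weak-coupling lattice mass gap (Chatterjee Problem 5.1 first half); nothing is proved for non-abelian G in d = 4 beyond strong coupling; a massless phase at some large β refutes it.
sources: arXiv:1803.01950, JaffeWitten2000, OsterwalderSeiler1978
[target] for every compact simple Lie group G and faithful unitary lattice representation r there is
β₀ with: for all β ≥ β₀ there are m > 0 and S₁ such that for all gauge-invariant local observables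
A, B there is C with |⟨A·τ_n B⟩ − ⟨A⟩⟨B⟩| ≤ C e^{−m n} on every torus (2S+1)⁴, S ≥ S₁, n ≤ S, under
Wilson's measure at coupling β (volume-uniform weak-coupling lattice mass gap; the
`latticeConnectedCorr` shape of `HasLatticeMassGap` at fixed β). -/
@[route_item "route-QuantumFields-HyperbolicRegulator"]
def UniformLatticeGap : Prop :=
  ∀ (G : Type) [Group G] [TopologicalSpace G] [IsTopologicalGroup G] [CompactSpace G] [MeasurableSpace G] [BorelSpace G], Literature.MathematicalPhysics.QuantumFieldTheory.IsCompactSimpleLieGroup G → ∀ r : Literature.MathematicalPhysics.QuantumFieldTheory.LatticeRep G, ∃ β₀ : ℝ, ∀ β : ℝ, β₀ ≤ β → ∃ m : ℝ, 0 < m ∧ ∃ S₁ : ℕ, ∀ A B : Literature.MathematicalPhysics.QuantumFieldTheory.YMSpecies G, ∃ C : ℝ, ∀ S n : ℕ, S₁ ≤ S → n ≤ S → |Literature.MathematicalPhysics.QuantumFieldTheory.latticeConnectedCorr r.ρ β (2 * S + 1) A.F B.F n| ≤ C * Real.exp (-(m * n))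

/-- item stmt-QuantumFields-15825 · crux · rank 2 · closed · vacuous by Summit.QuantumFields.YangMills.Cruxes.CurvatureUniformity.NoAdmissibleComplex.CurvatureUniformity_of_no_admissible @ 7e78b7a32379 (prover) · by operator
why it might fail: It contains the weak-coupling volume-uniform gap (flat regions of radius k/4 → ∞); FALSE for U(1) (expander photon mass ≍ 1/k → 0), so asymptotic freedom must enter; free ≠ wired hyperbolic states (2001 finding) could carry slow boundary-like modes at large β.
sources: arXiv:1210.5195, arXiv:2312.09277, arXiv:2407.06268, arXiv:1803.01950, doi:10.1016/0550-3213(90)90451-I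
[crux] (THE CRUX — uniformity in the curvature scale; the 2001 crux 'Δ₁(R) ≥ cR' in lattice clothes)
for every compact simple G and faithful unitary r and EVERY admissible hyperbolic family (k ≥ 8, all
j: finite square complex S_(k,j) ⊂ ℕ with oriented edges and squares, vertex degrees 4 or 5 with
#squares = degree and every edge in two squares, degree-5 cones pairwise ≥ k apart and k-dense,
Poincaré inequality Σf² ≤ 10⁶k²·Σ_E(∇f)² for mean-zero f, two deep points (> k/2 from all cones) at
distance ≥ j, and ℤ²-charts of radius k/4 at every flat point (> k/4 from all cones) matching
vertices, oriented edges and squares): IF the anchor conclusion holds (one c > 0 for all k ≥ 8 and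
thresholds β₀(k), with clustering at rate c/k of all chart-read gauge-invariant local observables of
support radius ≤ k/8 between flat base points of S×S, in the distance dist(x,y)+dist(x',y'),
constants C(A,B) uniform in j ≥ j₀), THEN there is β₁ such that for every β ≥ β₁ ONE rate m(β) > 0
gives the same clustering bound for ALL k ≥ 8 (constants C(A,B,k), j ≥ j₀(β,k,A,B)). [deps:
CurvatureAnchor] [difficulty: open-problem] -/
@[route_item "route-QuantumFields-HyperbolicRegulator"]
def CurvatureUniformity : Prop :=
  open Literature.MathematicalPhysics.QuantumFieldTheory Literature.MathematicalPhysics.QuantumLattice MeasureTheory in ∀ (G : Type) [Group G] [TopologicalSpace G] [IsTopologicalGroup G] [CompactSpace G], IsCompactSimpleLieGroup G → letI : MeasurableSpace G := borel G; haveI : BorelSpace G := ⟨rfl⟩; ∀ r : LatticeRep G, let Fam := fun (k j : ℕ) (V E Q : Finset ℕ) (σ τ : ℕ → ℕ) (bd : ℕ → Fin 4 → ℕ × Bool) (cV : ℕ → ℤ × ℤ → ℕ) (cE : ℕ → ℤ × ℤ → Fin 2 → ℕ × Bool) => let st := fun e : ℕ × Bool => if e.2 then σ e.1 else τ e.1;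 let en := fun e : ℕ × Bool => if e.2 then τ e.1 else σ e.1; let Γ := SimpleGraph.fromRel fun a b : ℕ => ∃ e ∈ E, σ e = a ∧ τ e = b; let dg := fun x : ℕ => (E.filter fun e => σ e = x ∨ τ e = x).card; let K := V.filter fun x => dg x = 5; let F := fun x : ℕ => x ∈ V ∧ ∀ c ∈ K, k / 4 < Γ.dist x c; let Dp := fun x : ℕ => x ∈ V ∧ ∀ c ∈ K, k / 2 < Γ.dist x c; let ib := fun a : ℤ × ℤ => |a.1| ≤ (k : ℤ) / 4 ∧ |a.2| ≤ (k : ℤ) / 4; let nx := fun (a : ℤ × ℤ) (μ : Fin 2) => if μ = 0 then (a.1 + 1, a.2) else (a.1, a.2 + 1); let Ed := (ℕ × ℕ) ⊕ (ℕ × ℕ); let PE : Finset Ed := (E ×ˢ V).disjSum (V ×ˢ E); let Cfg := ↥PE → G; let ν := Measure.pi fun _ : ↥PE => haarProbability G; let v := fun (U : Cfg) (e : Ed × Bool) => if h : e.1 ∈ PE then (if e.2 then U ⟨e.1, h⟩ else (U ⟨e.1, h⟩)⁻¹) else 1; let w := fun (U : Cfg) (e : Fin 4 → Ed × Bool) =>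 (r.ρ (v U (e 0) * v U (e 1) * v U (e 2) * v U (e 3))).trace.re; let S := fun U : Cfg => (∑ q ∈ Q, ∑ y ∈ V, w U fun i => (Sum.inl ((bd q i).1, y), (bd q i).2)) + (∑ y ∈ V, ∑ q ∈ Q, w U fun i => (Sum.inr (y, (bd q i).1), (bd q i).2)) + ∑ e ∈ E, ∑ e' ∈ E, w U ![(Sum.inl (e, σ e'), true), (Sum.inr (τ e, e'), true), (Sum.inl (e, τ e'), false), (Sum.inr (σ e, e'), false)]; let d0 : Fin 4 → Fin 2 := ![0, 1, 0, 1]; let P := fun (x x' : ℕ) (U : Cfg) (p : ZdEdge 4) => let a := (p.1 0, p.1 1); let b := (p.1 2, p.1 3); if p.2 = 0 ∨ p.2 = 1 then v U (Sum.inl ((cE x a (d0 p.2)).1, cV x' b), (cE x a (d0 p.2)).2) else v U (Sum.inr (cV x a, (cE x' b (d0 p.2)).1), (cE x' b (d0 p.2)).2); ((∀ e ∈ E, σ e ∈ V ∧ τ e ∈ V ∧ σ e ≠ τ e) ∧ (∀ q ∈ Q, (∀ i, (bd q i).1 ∈ E) ∧ (∀ i, en (bd q i) = st (bd q (i + 1)))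 ∧ (st ∘ bd q).Injective) ∧ (∀ e ∈ E, (Q.filter fun q => ∃ i, (bd q i).1 = e).card = 2) ∧ (∀ x ∈ V, (dg x = 4 ∨ dg x = 5) ∧ (Q.filter fun q => ∃ i, st (bd q i) = x).card = dg x) ∧ (∀ x ∈ V, ∃ c ∈ K, Γ.dist x c ≤ k) ∧ (∀ c ∈ K, ∀ c' ∈ K, c ≠ c' → k ≤ Γ.dist c c') ∧ (∀ f : ℕ → ℝ, ∑ x ∈ V, f x = 0 → ∑ x ∈ V, f x ^ 2 ≤ 10 ^ 6 * (k : ℝ) ^ 2 * ∑ e ∈ E, (f (σ e) - f (τ e)) ^ 2) ∧ (∃ x y, Dp x ∧ Dp y ∧ j ≤ Γ.dist x y) ∧ (∀ x, F x → cV x (0, 0) = x ∧ (∀ a, ib a → cV x a ∈ V) ∧ Set.InjOn (cV x) {a | ib a} ∧ (∀ a μ, ib a → ib (nx a μ) → (cE x a μ).1 ∈ E ∧ st (cE x a μ) = cV x a ∧ en (cE x a μ) = cV x (nx a μ)) ∧ (∀ a, ib a → ib (a.1 + 1, a.2 + 1) → ∃ q ∈ Q, Finset.univ.image (Prod.fst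 ∘ bd q) = {(cE x a 0).1, (cE x (nx a 0) 1).1, (cE x (nx a 1) 0).1, (cE x a 1).1})), fun (β m C : ℝ) (A B : YMSpecies G) => let X := fun f : Cfg → ℝ => (∫ U, f U * Real.exp (β * S U) ∂ν) / (∫ U, Real.exp (β * S U) ∂ν); ∀ x x' y y', F x → F x' → F y → F y' → |X (fun U => A.F (P x x' U) * B.F (P y y' U)) - X (fun U => A.F (P x x' U)) * X (fun U => B.F (P y y' U))| ≤ C * Real.exp (-(m * ((Γ.dist x y + Γ.dist x' y' : ℕ) : ℝ)))); let Sp := fun (A : YMSpecies G) (R : ℕ) => ∀ p ∈ A.supp, ∀ i, |p.1 i| ≤ (R : ℤ); ∀ (V E Q : ℕ → ℕ → Finset ℕ) (σ τ : ℕ → ℕ → ℕ → ℕ) (bd : ℕ → ℕ → ℕ → Fin 4 → ℕ × Bool) (cV : ℕ → ℕ → ℕ → ℤ × ℤ → ℕ) (cE : ℕ → ℕ → ℕ → ℤ × ℤ → Fin 2 → ℕ × Bool), let Φ := fun k j => Fam k j (V k j) (E k j) (Q k j) (σ k j) (τ k j) (bd k j) (cV k j) (cE k j); (∀ k j, 8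 ≤ k → (Φ k j).1) → (∃ c : ℝ, 0 < c ∧ ∀ k, 8 ≤ k → ∃ β₀ : ℝ, ∀ β, β₀ ≤ β → ∀ A B : YMSpecies G, Sp A (k / 8) → Sp B (k / 8) → ∃ C j₀, ∀ j, j₀ ≤ j → (Φ k j).2 β (c / k) C A B) → (∃ β₁ : ℝ, ∀ β, β₁ ≤ β → ∃ m : ℝ, 0 < m ∧ ∀ k, 8 ≤ k → ∀ A B : YMSpecies G, Sp A (k / 8) → Sp B (k / 8) → ∃ C j₀, ∀ j, j₀ ≤ j → (Φ k j).2 β m C A B)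

/-- item stmt-QuantumFields-18154 · crux · rank 2 · open · by planner
why it might fail: It contains the weak-coupling volume-uniform lattice gap (flat balls of radius k/4 → ∞ must cluster at a k-independent rate with k-uniform constants): Chatterjee Problem 5.1 in hyperbolic clothes; FALSE for U(1) (expander photon mass ≍ 1/k → 0); wired-type slow modes at large β.
sources: arXiv:1210.5195, arXiv:2312.09277, arXiv:2407.06268, arXiv:1803.01950, doi:10.1016/0550-3213(90)90451-I
[crux] REPAIRED CurvatureUniformity (supersedes stmt-QuantumFields-15825, closed `proved` VACUOUSLY:
the pre-repair admissibility antecedent was unsatisfiable for k ≥ 208,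
NoAdmissibleComplex.no_admissible). THE CRUX — uniformity in the curvature scale, typed as its
INFRARED CORE with k-UNIFORM CONSTANTS: for every compact simple G, faithful unitary r and EVERY
admissible hyperbolic family (repaired `Fam`, byte-identical with CurvatureAnchorR /
HyperbolicToTorusR: flat = dist > k/2 to every cone, deep = dist > 3(k/4), injective ℤ²-charts of
sup-radius k/4 at flat points — no chart meets a cone), IF the anchor holds (one c > 0, thresholds
β₀(k), rate c/k, constants after k), THEN ∃ β₁ ∀ β ≥ β₁ ∃ m(β) > 0 ∀ A B ∃ C K ∀ k ≥ K (Sp A (k/8),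
Sp B (k/8)) ∃ j₀ ∀ j ≥ j₀: the clustering predicate at rate m with constant C. Two re-typings ride
on the lockstep Fam repair: (R2) ∃ C before ∀ k (HyperbolicToTorus disprover F3: with C after k the
bound is silent below scale k and the torus step has nothing to inherit); (I) eventual in k
(REGLUE-ADVICE: `closes` consumes this crux only through HyperbolicToTorusR, which uses k → ∞ alone;
the per-scale onset band ∀ k ≥ 8 — strategist N2, the one phys -/
@[route_item "route-QuantumFields-HyperbolicRegulator"]
def CurvatureUniformityR : Prop :=
  open Literature.MathematicalPhysics.QuantumFieldTheory Literature.MathematicalPhysics.QuantumLattice MeasureTheory in ∀ (G : Type) [Group G] [TopologicalSpace G] [IsTopologicalGroup G] [CompactSpace G], IsCompactSimpleLieGroup G → letI : MeasurableSpace G := borel G; haveI : BorelSpace G := ⟨rfl⟩; ∀ r : LatticeRep G, let Fam := fun (k j : ℕ) (V E Q : Finset ℕ) (σ τ : ℕ → ℕ) (bd : ℕ → Fin 4 → ℕ × Bool) (cV : ℕ → ℤ × ℤ → ℕ) (cE : ℕ → ℤ × ℤ → Fin 2 → ℕ × Bool) => let st := fun e : ℕ × Bool => if e.2 then σ e.1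 else τ e.1; let en := fun e : ℕ × Bool => if e.2 then τ e.1 else σ e.1; let Γ := SimpleGraph.fromRel fun a b : ℕ => ∃ e ∈ E, σ e = a ∧ τ e = b; let dg := fun x : ℕ => (E.filter fun e => σ e = x ∨ τ e = x).card; let K := V.filter fun x => dg x = 5; let F := fun x : ℕ => x ∈ V ∧ ∀ c ∈ K, k / 2 < Γ.dist x c; let Dp := fun x : ℕ => x ∈ V ∧ ∀ c ∈ K, 3 * (k / 4) < Γ.dist x c; let ib := fun a : ℤ × ℤ => |a.1| ≤ (k : ℤ) / 4 ∧ |a.2| ≤ (k : ℤ) / 4; let nx := fun (a : ℤ × ℤ) (μ : Fin 2) => if μ = 0 then (a.1 + 1, a.2) else (a.1, a.2 + 1); let Ed := (ℕ × ℕ) ⊕ (ℕ × ℕ); let PE : Finset Ed := (E ×ˢ V).disjSum (V ×ˢ E); let Cfg := ↥PE → G; let ν := Measure.pi fun _ : ↥PE => haarProbability G; let v := fun (U : Cfg) (e : Ed × Bool) => if h : e.1 ∈ PE then (if e.2 then U ⟨e.1, h⟩ else (U ⟨e.1, h⟩)⁻¹) else 1; let w := fun (U : Cfg) (e : Fin 4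 → Ed × Bool) => (r.ρ (v U (e 0) * v U (e 1) * v U (e 2) * v U (e 3))).trace.re; let S := fun U : Cfg => (∑ q ∈ Q, ∑ y ∈ V, w U fun i => (Sum.inl ((bd q i).1, y), (bd q i).2)) + (∑ y ∈ V, ∑ q ∈ Q, w U fun i => (Sum.inr (y, (bd q i).1), (bd q i).2)) + ∑ e ∈ E, ∑ e' ∈ E, w U ![(Sum.inl (e, σ e'), true), (Sum.inr (τ e, e'), true), (Sum.inl (e, τ e'), false), (Sum.inr (σ e, e'), false)]; let d0 : Fin 4 → Fin 2 := ![0, 1, 0, 1]; let P := fun (x x' : ℕ) (U : Cfg) (p : ZdEdge 4) => let a := (p.1 0, p.1 1); let b := (p.1 2, p.1 3); if p.2 = 0 ∨ p.2 = 1 then v U (Sum.inl ((cE x a (d0 p.2)).1, cV x' b), (cE x a (d0 p.2)).2) else v U (Sum.inr (cV x a, (cE x' b (d0 p.2)).1), (cE x' b (d0 p.2)).2); ((∀ e ∈ E, σ e ∈ V ∧ τ e ∈ V ∧ σ e ≠ τ e) ∧ (∀ q ∈ Q, (∀ i, (bd q i).1 ∈ E) ∧ (∀ i, en (bd q i) =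 st (bd q (i + 1))) ∧ (st ∘ bd q).Injective) ∧ (∀ e ∈ E, (Q.filter fun q => ∃ i, (bd q i).1 = e).card = 2) ∧ (∀ x ∈ V, (dg x = 4 ∨ dg x = 5) ∧ (Q.filter fun q => ∃ i, st (bd q i) = x).card = dg x) ∧ (∀ x ∈ V, ∃ c ∈ K, Γ.dist x c ≤ k) ∧ (∀ c ∈ K, ∀ c' ∈ K, c ≠ c' → k ≤ Γ.dist c c') ∧ (∀ f : ℕ → ℝ, ∑ x ∈ V, f x = 0 → ∑ x ∈ V, f x ^ 2 ≤ 10 ^ 6 * (k : ℝ) ^ 2 * ∑ e ∈ E, (f (σ e) - f (τ e)) ^ 2) ∧ (∃ x y, Dp x ∧ Dp y ∧ j ≤ Γ.dist x y) ∧ (∀ x, F x → cV x (0, 0) = x ∧ (∀ a, ib a → cV x a ∈ V) ∧ Set.InjOn (cV x) {a | ib a} ∧ (∀ a μ, ib a → ib (nx a μ) → (cE x a μ).1 ∈ E ∧ st (cE x a μ) = cV x a ∧ en (cE x a μ) = cV x (nx a μ)) ∧ (∀ a, ib a → ib (a.1 + 1, a.2 + 1) → ∃ q ∈ Q, Finset.univ.image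 (Prod.fst ∘ bd q) = {(cE x a 0).1, (cE x (nx a 0) 1).1, (cE x (nx a 1) 0).1, (cE x a 1).1})), fun (β m C : ℝ) (A B : YMSpecies G) => let X := fun f : Cfg → ℝ => (∫ U, f U * Real.exp (β * S U) ∂ν) / (∫ U, Real.exp (β * S U) ∂ν); ∀ x x' y y', F x → F x' → F y → F y' → |X (fun U => A.F (P x x' U) * B.F (P y y' U)) - X (fun U => A.F (P x x' U)) * X (fun U => B.F (P y y' U))| ≤ C * Real.exp (-(m * ((Γ.dist x y + Γ.dist x' y' : ℕ) : ℝ)))); let Sp := fun (A : YMSpecies G) (R : ℕ) => ∀ p ∈ A.supp, ∀ i, |p.1 i| ≤ (R : ℤ); ∀ (V E Q : ℕ → ℕ → Finset ℕ) (σ τ : ℕ → ℕ → ℕ → ℕ) (bd : ℕ → ℕ → ℕ → Fin 4 → ℕ × Bool) (cV : ℕ → ℕ → ℕ → ℤ × ℤ → ℕ) (cE : ℕ → ℕ → ℕ → ℤ × ℤ → Fin 2 → ℕ × Bool), let Φ := fun k j => Fam k j (V k j) (E k j) (Q k j) (σ k j) (τ k j) (bd k j) (cV k j) (cE k j); (∀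 k j, 8 ≤ k → (Φ k j).1) → (∃ c : ℝ, 0 < c ∧ ∀ k, 8 ≤ k → ∃ β₀ : ℝ, ∀ β, β₀ ≤ β → ∀ A B : YMSpecies G, Sp A (k / 8) → Sp B (k / 8) → ∃ C j₀, ∀ j, j₀ ≤ j → (Φ k j).2 β (c / k) C A B) → (∃ β₁ : ℝ, ∀ β, β₁ ≤ β → ∃ m : ℝ, 0 < m ∧ ∀ A B : YMSpecies G, ∃ C : ℝ, ∃ K : ℕ, ∀ k, K ≤ k → Sp A (k / 8) → Sp B (k / 8) → ∃ j₀ : ℕ, ∀ j, j₀ ≤ j → (Φ k j).2 β m C A B)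

/-- item stmt-QuantumFields-18155 · crux · rank 3 · open · by planner
why it might fail: Torons of the finite approximants (b₁ = 4g_j flat directions) may put a j-uniform floor under chart-read covariances at fixed (k, β); expander + large-girth square-complex towers and ≍ log k Bałaban steps on a curved 4-complex are unprinted (RG-I Thm 2, PERT-2 gaps).
sources: arXiv:2003.10911, arXiv:2107.05292, arXiv:2003.05892, Balaban1989, OsterwalderSeiler1978, arXiv:1210.5195
[crux] REPAIRED CurvatureAnchor = C′ of Summit.QuantumFields.YangMills.Theorems.not_CurvatureAnchor
(supersedes stmt-QuantumFields-15826, refuted-MISSTATED: the flat threshold `k/4 < dist x c`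
equalled the chart sup-radius `(k:ℤ)/4`, so no complex was admissible for k ≥ 208; witness SU(2) +
no_admissible at (400, 0)). ONLY CHANGE (R-a, refuters R3/ATTACK-15826/VETTING, strategist censuses,
disprover's typed `Cruxes.CurvatureAnchor.Disproof.CurvatureAnchorR`, byte-identical): `let F := … k
/ 2 < Γ.dist x c` and `let Dp := … 3 * (k / 4) < Γ.dist x c`, chart box `(k:ℤ)/4` unchanged — chart
reach 2⌊k/4⌋ ≤ ⌊k/2⌋, so no chart meets a cone (kernel-checked `AdmR.chart_avoids_cones`), and every
repaired-flat point of the intended {4,5}_k patch is charted for k = 8..20 (repair_check.py).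
CONSTRUCTION + ANCHOR: for every compact simple G and faithful unitary r THERE IS a family (V, E, Q,
σ, τ, bd, cV, cE indexed by k, j) admissible for all k ≥ 8 and all j, and ONE c > 0 such that for
every k ≥ 8 there is β₀(k) with: for β ≥ β₀(k) and all YMSpecies A, B of support radius ≤ k/8 there
are C, j₀ such that for j ≥ j₀ all chart-read copies at flat base points of S_(k,j) × S_(k,j)
cluster at rate c/ -/
@[route_item "route-QuantumFields-HyperbolicRegulator"]
def CurvatureAnchorR : Prop :=
  open Literature.MathematicalPhysics.QuantumFieldTheory Literature.MathematicalPhysics.QuantumLattice MeasureTheory in ∀ (G : Type) [Group G] [TopologicalSpace G] [IsTopologicalGroup G] [CompactSpace G], IsCompactSimpleLieGroup G → letI : MeasurableSpace G := borel G; haveI : BorelSpace G := ⟨rfl⟩; ∀ r : LatticeRep G, let Fam := fun (k j : ℕ) (V E Q : Finset ℕ) (σ τ : ℕ → ℕ) (bd : ℕ → Fin 4 → ℕ × Bool) (cV : ℕ → ℤ × ℤ → ℕ) (cE : ℕ → ℤ × ℤ → Fin 2 → ℕ × Bool) => let st := fun e : ℕ × Bool => if e.2 then σ e.1 else τ e.1;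 let en := fun e : ℕ × Bool => if e.2 then τ e.1 else σ e.1; let Γ := SimpleGraph.fromRel fun a b : ℕ => ∃ e ∈ E, σ e = a ∧ τ e = b; let dg := fun x : ℕ => (E.filter fun e => σ e = x ∨ τ e = x).card; let K := V.filter fun x => dg x = 5; let F := fun x : ℕ => x ∈ V ∧ ∀ c ∈ K, k / 2 < Γ.dist x c; let Dp := fun x : ℕ => x ∈ V ∧ ∀ c ∈ K, 3 * (k / 4) < Γ.dist x c; let ib := fun a : ℤ × ℤ => |a.1| ≤ (k : ℤ) / 4 ∧ |a.2| ≤ (k : ℤ) / 4; let nx := fun (a : ℤ × ℤ) (μ : Fin 2) => if μ = 0 then (a.1 + 1, a.2) else (a.1, a.2 + 1); let Ed := (ℕ × ℕ) ⊕ (ℕ × ℕ); let PE : Finset Ed := (E ×ˢ V).disjSum (V ×ˢ E); let Cfg := ↥PE → G; let ν := Measure.pi fun _ : ↥PE => haarProbability G; let v := fun (U : Cfg) (e : Ed × Bool) => if h : e.1 ∈ PE then (if e.2 then U ⟨e.1, h⟩ else (U ⟨e.1, h⟩)⁻¹) else 1; let w := fun (U : Cfg) (e : Fin 4 → Ed ×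 Bool) => (r.ρ (v U (e 0) * v U (e 1) * v U (e 2) * v U (e 3))).trace.re; let S := fun U : Cfg => (∑ q ∈ Q, ∑ y ∈ V, w U fun i => (Sum.inl ((bd q i).1, y), (bd q i).2)) + (∑ y ∈ V, ∑ q ∈ Q, w U fun i => (Sum.inr (y, (bd q i).1), (bd q i).2)) + ∑ e ∈ E, ∑ e' ∈ E, w U ![(Sum.inl (e, σ e'), true), (Sum.inr (τ e, e'), true), (Sum.inl (e, τ e'), false), (Sum.inr (σ e, e'), false)]; let d0 : Fin 4 → Fin 2 := ![0, 1, 0, 1]; let P := fun (x x' : ℕ) (U : Cfg) (p : ZdEdge 4) => let a := (p.1 0, p.1 1); let b := (p.1 2, p.1 3); if p.2 = 0 ∨ p.2 = 1 then v U (Sum.inl ((cE x a (d0 p.2)).1, cV x' b), (cE x a (d0 p.2)).2) else v U (Sum.inr (cV x a, (cE x' b (d0 p.2)).1), (cE x' b (d0 p.2)).2); ((∀ e ∈ E, σ e ∈ V ∧ τ e ∈ V ∧ σ e ≠ τ e) ∧ (∀ q ∈ Q, (∀ i, (bd q i).1 ∈ E) ∧ (∀ i, en (bd q i) = st (bd q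 (i + 1))) ∧ (st ∘ bd q).Injective) ∧ (∀ e ∈ E, (Q.filter fun q => ∃ i, (bd q i).1 = e).card = 2) ∧ (∀ x ∈ V, (dg x = 4 ∨ dg x = 5) ∧ (Q.filter fun q => ∃ i, st (bd q i) = x).card = dg x) ∧ (∀ x ∈ V, ∃ c ∈ K, Γ.dist x c ≤ k) ∧ (∀ c ∈ K, ∀ c' ∈ K, c ≠ c' → k ≤ Γ.dist c c') ∧ (∀ f : ℕ → ℝ, ∑ x ∈ V, f x = 0 → ∑ x ∈ V, f x ^ 2 ≤ 10 ^ 6 * (k : ℝ) ^ 2 * ∑ e ∈ E, (f (σ e) - f (τ e)) ^ 2) ∧ (∃ x y, Dp x ∧ Dp y ∧ j ≤ Γ.dist x y) ∧ (∀ x, F x → cV x (0, 0) = x ∧ (∀ a, ib a → cV x a ∈ V) ∧ Set.InjOn (cV x) {a | ib a} ∧ (∀ a μ, ib a → ib (nx a μ) → (cE x a μ).1 ∈ E ∧ st (cE x a μ) = cV x a ∧ en (cE x a μ) = cV x (nx a μ)) ∧ (∀ a, ib a → ib (a.1 + 1, a.2 + 1) → ∃ q ∈ Q, Finset.univ.image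 (Prod.fst ∘ bd q) = {(cE x a 0).1, (cE x (nx a 0) 1).1, (cE x (nx a 1) 0).1, (cE x a 1).1})), fun (β m C : ℝ) (A B : YMSpecies G) => let X := fun f : Cfg → ℝ => (∫ U, f U * Real.exp (β * S U) ∂ν) / (∫ U, Real.exp (β * S U) ∂ν); ∀ x x' y y', F x → F x' → F y → F y' → |X (fun U => A.F (P x x' U) * B.F (P y y' U)) - X (fun U => A.F (P x x' U)) * X (fun U => B.F (P y y' U))| ≤ C * Real.exp (-(m * ((Γ.dist x y + Γ.dist x' y' : ℕ) : ℝ)))); let Sp := fun (A : YMSpecies G) (R : ℕ) => ∀ p ∈ A.supp, ∀ i, |p.1 i| ≤ (R : ℤ); ∃ (V E Q : ℕ → ℕ → Finset ℕ) (σ τ : ℕ → ℕ → ℕ → ℕ) (bd : ℕ → ℕ → ℕ → Fin 4 → ℕ × Bool) (cV : ℕ → ℕ → ℕ → ℤ × ℤ → ℕ) (cE : ℕ → ℕ → ℕ → ℤ × ℤ → Fin 2 → ℕ × Bool), let Φ := fun k j => Fam k j (V k j) (E k j) (Q k j) (σ k j) (τ k j) (bd k j) (cV k j) (cE k j); (∀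 k j, 8 ≤ k → (Φ k j).1) ∧ (∃ c : ℝ, 0 < c ∧ ∀ k, 8 ≤ k → ∃ β₀ : ℝ, ∀ β, β₀ ≤ β → ∀ A B : YMSpecies G, Sp A (k / 8) → Sp B (k / 8) → ∃ C j₀, ∀ j, j₀ ≤ j → (Φ k j).2 β (c / k) C A B)

/-- item stmt-QuantumFields-15827 · crux · rank 4 · closed · vacuous by Summit.QuantumFields.YangMills.Cruxes.HyperbolicToTorus.NoAdmissibleComplex.HyperbolicToTorus_of_no_admissible @ 6cbdad3e0e44 (prover) · by operator
why it might fail: Hyperbolic-limit Gibbs states need not equal torus-limit states at weak coupling (ℤ⁴ Gibbs uniqueness at large β is open; 2001 found free ≠ wired on hyperbolic lattices); S-uniform torus constants need Casimir/vacuum dominance, not just a gap.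
sources: OsterwalderSeiler1978, Seiler1982, arXiv:1803.01950, arXiv:2006.16229
[crux] (HYPERBOLIC FAMILY ⇒ SYMMETRIC TORUS) for every compact simple G, faithful unitary r and
every admissible hyperbolic family: IF one rate m(β) > 0 clusters the family for all k ≥ 8 at every
β ≥ β₁ (verbatim the conclusion of CurvatureUniformity), THEN the UniformLatticeGap body holds for r
(β₀; for β ≥ β₀ a rate m > 0 and S₁ with |latticeConnectedCorr r.ρ β (2S+1) A.F B.F n| ≤ C(A,B)
e^(−m n) for all YMSpecies A, B, S ≥ S₁, n ≤ S). Intended proof: the deep flat balls of radius k/4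
carry Wilson–DLR conditional laws, so k → ∞ (j ≥ j₀) local limits are translation-covariant flat
Gibbs states of Wilson's specification at β clustering at rate m with the inherited constants
(charts at different base points differ by hypercubic motions, which permute YMSpecies); identify
them with periodic-torus states on gauge-invariant local observables and transfer to
latticeConnectedCorr on (2S+1)⁴ with S-uniform constants (vacuum dominance for n ≤ S, the 2001
ergodic-passage rows W_fin⁰ ∧ (VD⁰) ⇒ gap). [deps: CurvatureUniformity] [difficulty: L] -/
@[route_item "route-QuantumFields-HyperbolicRegulator"]
def HyperbolicToTorus : Prop :=
  open Literature.MathematicalPhysics.QuantumFieldTheory Literature.MathematicalPhysics.QuantumLattice MeasureTheory in ∀ (G : Type) [Group G] [TopologicalSpace G] [IsTopologicalGroup G] [CompactSpace G], IsCompactSimpleLieGroup G → letI : MeasurableSpace G := borel G; haveI : BorelSpace G := ⟨rfl⟩; ∀ r : LatticeRep G, let Fam := fun (k j : ℕ) (V E Q : Finset ℕ) (σ τ : ℕ → ℕ) (bd : ℕ → Fin 4 → ℕ × Bool) (cV : ℕ → ℤ × ℤ → ℕ) (cE : ℕ → ℤ × ℤ → Fin 2 → ℕ × Bool) => let st :=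 fun e : ℕ × Bool => if e.2 then σ e.1 else τ e.1; let en := fun e : ℕ × Bool => if e.2 then τ e.1 else σ e.1; let Γ := SimpleGraph.fromRel fun a b : ℕ => ∃ e ∈ E, σ e = a ∧ τ e = b; let dg := fun x : ℕ => (E.filter fun e => σ e = x ∨ τ e = x).card; let K := V.filter fun x => dg x = 5; let F := fun x : ℕ => x ∈ V ∧ ∀ c ∈ K, k / 4 < Γ.dist x c; let Dp := fun x : ℕ => x ∈ V ∧ ∀ c ∈ K, k / 2 < Γ.dist x c; let ib := fun a : ℤ × ℤ => |a.1| ≤ (k : ℤ) / 4 ∧ |a.2| ≤ (k : ℤ) / 4; let nx := fun (a : ℤ × ℤ) (μ : Fin 2) => if μ = 0 then (a.1 + 1, a.2) else (a.1, a.2 + 1); let Ed := (ℕ × ℕ) ⊕ (ℕ × ℕ); let PE : Finset Ed := (E ×ˢ V).disjSum (V ×ˢ E); let Cfg := ↥PE → G; let ν := Measure.pi fun _ : ↥PE => haarProbability G; let v := fun (U : Cfg) (e : Ed × Bool) => if h : e.1 ∈ PE then (if e.2 then U ⟨e.1, h⟩ else (U ⟨e.1, h⟩)⁻¹) else 1;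 let w := fun (U : Cfg) (e : Fin 4 → Ed × Bool) => (r.ρ (v U (e 0) * v U (e 1) * v U (e 2) * v U (e 3))).trace.re; let S := fun U : Cfg => (∑ q ∈ Q, ∑ y ∈ V, w U fun i => (Sum.inl ((bd q i).1, y), (bd q i).2)) + (∑ y ∈ V, ∑ q ∈ Q, w U fun i => (Sum.inr (y, (bd q i).1), (bd q i).2)) + ∑ e ∈ E, ∑ e' ∈ E, w U ![(Sum.inl (e, σ e'), true), (Sum.inr (τ e, e'), true), (Sum.inl (e, τ e'), false), (Sum.inr (σ e, e'), false)]; let d0 : Fin 4 → Fin 2 := ![0, 1, 0, 1]; let P := fun (x x' : ℕ) (U : Cfg) (p : ZdEdge 4) => let a := (p.1 0, p.1 1); let b := (p.1 2, p.1 3); if p.2 = 0 ∨ p.2 = 1 then v U (Sum.inl ((cE x a (d0 p.2)).1, cV x' b), (cE x a (d0 p.2)).2) else v U (Sum.inr (cV x a, (cE x' b (d0 p.2)).1), (cE x' b (d0 p.2)).2); ((∀ e ∈ E, σ e ∈ V ∧ τ e ∈ V ∧ σ e ≠ τ e) ∧ (∀ q ∈ Q, (∀ i, (bd q i).1 ∈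 E) ∧ (∀ i, en (bd q i) = st (bd q (i + 1))) ∧ (st ∘ bd q).Injective) ∧ (∀ e ∈ E, (Q.filter fun q => ∃ i, (bd q i).1 = e).card = 2) ∧ (∀ x ∈ V, (dg x = 4 ∨ dg x = 5) ∧ (Q.filter fun q => ∃ i, st (bd q i) = x).card = dg x) ∧ (∀ x ∈ V, ∃ c ∈ K, Γ.dist x c ≤ k) ∧ (∀ c ∈ K, ∀ c' ∈ K, c ≠ c' → k ≤ Γ.dist c c') ∧ (∀ f : ℕ → ℝ, ∑ x ∈ V, f x = 0 → ∑ x ∈ V, f x ^ 2 ≤ 10 ^ 6 * (k : ℝ) ^ 2 * ∑ e ∈ E, (f (σ e) - f (τ e)) ^ 2) ∧ (∃ x y, Dp x ∧ Dp y ∧ j ≤ Γ.dist x y) ∧ (∀ x, F x → cV x (0, 0) = x ∧ (∀ a, ib a → cV x a ∈ V) ∧ Set.InjOn (cV x) {a | ib a} ∧ (∀ a μ, ib a → ib (nx a μ) → (cE x a μ).1 ∈ E ∧ st (cE x a μ) = cV x a ∧ en (cE x a μ) = cV x (nx a μ)) ∧ (∀ a, ib a → ib (a.1 + 1, a.2 +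 1) → ∃ q ∈ Q, Finset.univ.image (Prod.fst ∘ bd q) = {(cE x a 0).1, (cE x (nx a 0) 1).1, (cE x (nx a 1) 0).1, (cE x a 1).1})), fun (β m C : ℝ) (A B : YMSpecies G) => let X := fun f : Cfg → ℝ => (∫ U, f U * Real.exp (β * S U) ∂ν) / (∫ U, Real.exp (β * S U) ∂ν); ∀ x x' y y', F x → F x' → F y → F y' → |X (fun U => A.F (P x x' U) * B.F (P y y' U)) - X (fun U => A.F (P x x' U)) * X (fun U => B.F (P y y' U))| ≤ C * Real.exp (-(m * ((Γ.dist x y + Γ.dist x' y' : ℕ) : ℝ)))); let Sp := fun (A : YMSpecies G) (R : ℕ) => ∀ p ∈ A.supp, ∀ i, |p.1 i| ≤ (R : ℤ); ∀ (V E Q : ℕ → ℕ → Finset ℕ) (σ τ : ℕ → ℕ → ℕ → ℕ) (bd : ℕ → ℕ → ℕ → Fin 4 → ℕ × Bool) (cV : ℕ → ℕ → ℕ → ℤ × ℤ → ℕ) (cE : ℕ → ℕ → ℕ → ℤ × ℤ → Fin 2 → ℕ × Bool), let Φ := fun k j => Fam k j (V k j) (E k j) (Q k j) (σ k j) (τ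 k j) (bd k j) (cV k j) (cE k j); (∀ k j, 8 ≤ k → (Φ k j).1) → (∃ β₁ : ℝ, ∀ β, β₁ ≤ β → ∃ m : ℝ, 0 < m ∧ ∀ k, 8 ≤ k → ∀ A B : YMSpecies G, Sp A (k / 8) → Sp B (k / 8) → ∃ C j₀, ∀ j, j₀ ≤ j → (Φ k j).2 β m C A B) → ∃ β₀ : ℝ, ∀ β, β₀ ≤ β → ∃ m : ℝ, 0 < m ∧ ∃ S₁ : ℕ, ∀ A B : YMSpecies G, ∃ C : ℝ, ∀ S n, S₁ ≤ S → n ≤ S → |latticeConnectedCorr r.ρ β (2 * S + 1) A.F B.F n| ≤ C * Real.exp (-(m * n))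

/-- item stmt-QuantumFields-18156 · crux · rank 4 · open · by planner
why it might fail: Chart-local limits of hyperbolic states need not be the torus-limit phase at weak coupling (ℤ⁴ DLR uniqueness at large β open; free ≠ wired on hyperbolic lattices, 2001 finding); S-uniform torus constants for n ≤ S need a torus-law influence bound, not just one clustering state.
sources: OsterwalderSeiler1978, Seiler1982, arXiv:1803.01950, arXiv:2006.16229, doi:10.1007/BF01011153
[crux] REPAIRED HyperbolicToTorus (supersedes stmt-QuantumFields-15827, closed `proved` VACUOUSLY
via no_admissible). HYPERBOLIC FAMILY ⇒ SYMMETRIC TORUS: for every compact simple G, faithful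
unitary r and every admissible hyperbolic family (repaired `Fam`): IF one rate m(β) > 0 clusters the
family with k-UNIFORM constants for all large k at every β ≥ β₁ (VERBATIM the conclusion of
CurvatureUniformityR: ∀ A B ∃ C K ∀ k ≥ K … ∃ j₀ ∀ j ≥ j₀), THEN the UniformLatticeGap body holds at
(G, r) (∃ β₀ ∀ β ≥ β₀ ∃ m > 0 ∃ S₁ ∀ A B ∃ C ∀ S ≥ S₁ ∀ n ≤ S, |latticeConnectedCorr r.ρ β (2S+1)
A.F B.F n| ≤ C e^(−m n)) — verbatim the hypothesis of ContinuumLegGivenGap. Intended proof: deep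
flat balls (sup-radius k/4 → ∞, more than k/4 inside the flat region) carry Wilson–DLR conditional
laws, so chart-local limits k → ∞ (j ≥ j₀) are translation-covariant flat Wilson Gibbs states
clustering at rate m WITH the inherited constants C(A,B) (this is what R2 buys; charts at different
base points differ by hypercubic motions, which permute YMSpecies); identification with
periodic-torus states on gauge-invariant local observables and transfer to latticeConnectedCorr on
(2S+1)⁴ with S-uniform constants — stra -/
@[route_item "route-QuantumFields-HyperbolicRegulator"]
def HyperbolicToTorusR : Prop :=
  open Literature.MathematicalPhysics.QuantumFieldTheory Literature.MathematicalPhysics.QuantumLattice MeasureTheory in ∀ (G : Type) [Group G] [TopologicalSpace G] [IsTopologicalGroup G] [CompactSpace G], IsCompactSimpleLieGroup G → letI : MeasurableSpace G := borel G; haveI : BorelSpace G := ⟨rfl⟩; ∀ r : LatticeRep G, let Fam := fun (k j : ℕ) (V E Q : Finset ℕ) (σ τ : ℕ → ℕ) (bd : ℕ → Fin 4 → ℕ × Bool) (cV : ℕ → ℤ × ℤ → ℕ) (cE : ℕ → ℤ × ℤ → Fin 2 → ℕ × Bool) => let st := fun e : ℕ × Bool => if e.2 then σ e.1 else τ e.1;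 let en := fun e : ℕ × Bool => if e.2 then τ e.1 else σ e.1; let Γ := SimpleGraph.fromRel fun a b : ℕ => ∃ e ∈ E, σ e = a ∧ τ e = b; let dg := fun x : ℕ => (E.filter fun e => σ e = x ∨ τ e = x).card; let K := V.filter fun x => dg x = 5; let F := fun x : ℕ => x ∈ V ∧ ∀ c ∈ K, k / 2 < Γ.dist x c; let Dp := fun x : ℕ => x ∈ V ∧ ∀ c ∈ K, 3 * (k / 4) < Γ.dist x c; let ib := fun a : ℤ × ℤ => |a.1| ≤ (k : ℤ) / 4 ∧ |a.2| ≤ (k : ℤ) / 4; let nx := fun (a : ℤ × ℤ) (μ : Fin 2) => if μ = 0 then (a.1 + 1, a.2) else (a.1, a.2 + 1); let Ed := (ℕ × ℕ) ⊕ (ℕ × ℕ); let PE : Finset Ed := (E ×ˢ V).disjSum (V ×ˢ E); let Cfg := ↥PE → G; let ν := Measure.pi fun _ : ↥PE => haarProbability G; let v := fun (U : Cfg) (e : Ed × Bool) => if h : e.1 ∈ PE then (if e.2 then U ⟨e.1, h⟩ else (U ⟨e.1, h⟩)⁻¹) else 1; let w := fun (U : Cfg) (e : Fin 4 → Ed ×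 Bool) => (r.ρ (v U (e 0) * v U (e 1) * v U (e 2) * v U (e 3))).trace.re; let S := fun U : Cfg => (∑ q ∈ Q, ∑ y ∈ V, w U fun i => (Sum.inl ((bd q i).1, y), (bd q i).2)) + (∑ y ∈ V, ∑ q ∈ Q, w U fun i => (Sum.inr (y, (bd q i).1), (bd q i).2)) + ∑ e ∈ E, ∑ e' ∈ E, w U ![(Sum.inl (e, σ e'), true), (Sum.inr (τ e, e'), true), (Sum.inl (e, τ e'), false), (Sum.inr (σ e, e'), false)]; let d0 : Fin 4 → Fin 2 := ![0, 1, 0, 1]; let P := fun (x x' : ℕ) (U : Cfg) (p : ZdEdge 4) => let a := (p.1 0, p.1 1); let b := (p.1 2, p.1 3); if p.2 = 0 ∨ p.2 = 1 then v U (Sum.inl ((cE x a (d0 p.2)).1, cV x' b), (cE x a (d0 p.2)).2) else v U (Sum.inr (cV x a, (cE x' b (d0 p.2)).1), (cE x' b (d0 p.2)).2); ((∀ e ∈ E, σ e ∈ V ∧ τ e ∈ V ∧ σ e ≠ τ e) ∧ (∀ q ∈ Q, (∀ i, (bd q i).1 ∈ E) ∧ (∀ i, en (bd q i) = st (bd q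 (i + 1))) ∧ (st ∘ bd q).Injective) ∧ (∀ e ∈ E, (Q.filter fun q => ∃ i, (bd q i).1 = e).card = 2) ∧ (∀ x ∈ V, (dg x = 4 ∨ dg x = 5) ∧ (Q.filter fun q => ∃ i, st (bd q i) = x).card = dg x) ∧ (∀ x ∈ V, ∃ c ∈ K, Γ.dist x c ≤ k) ∧ (∀ c ∈ K, ∀ c' ∈ K, c ≠ c' → k ≤ Γ.dist c c') ∧ (∀ f : ℕ → ℝ, ∑ x ∈ V, f x = 0 → ∑ x ∈ V, f x ^ 2 ≤ 10 ^ 6 * (k : ℝ) ^ 2 * ∑ e ∈ E, (f (σ e) - f (τ e)) ^ 2) ∧ (∃ x y, Dp x ∧ Dp y ∧ j ≤ Γ.dist x y) ∧ (∀ x, F x → cV x (0, 0) = x ∧ (∀ a, ib a → cV x a ∈ V) ∧ Set.InjOn (cV x) {a | ib a} ∧ (∀ a μ, ib a → ib (nx a μ) → (cE x a μ).1 ∈ E ∧ st (cE x a μ) = cV x a ∧ en (cE x a μ) = cV x (nx a μ)) ∧ (∀ a, ib a → ib (a.1 + 1, a.2 + 1) → ∃ q ∈ Q, Finset.univ.image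 (Prod.fst ∘ bd q) = {(cE x a 0).1, (cE x (nx a 0) 1).1, (cE x (nx a 1) 0).1, (cE x a 1).1})), fun (β m C : ℝ) (A B : YMSpecies G) => let X := fun f : Cfg → ℝ => (∫ U, f U * Real.exp (β * S U) ∂ν) / (∫ U, Real.exp (β * S U) ∂ν); ∀ x x' y y', F x → F x' → F y → F y' → |X (fun U => A.F (P x x' U) * B.F (P y y' U)) - X (fun U => A.F (P x x' U)) * X (fun U => B.F (P y y' U))| ≤ C * Real.exp (-(m * ((Γ.dist x y + Γ.dist x' y' : ℕ) : ℝ)))); let Sp := fun (A : YMSpecies G) (R : ℕ) => ∀ p ∈ A.supp, ∀ i, |p.1 i| ≤ (R : ℤ); ∀ (V E Q : ℕ → ℕ → Finset ℕ) (σ τ : ℕ → ℕ → ℕ → ℕ) (bd : ℕ → ℕ → ℕ → Fin 4 → ℕ × Bool) (cV : ℕ → ℕ → ℕ → ℤ × ℤ → ℕ) (cE : ℕ → ℕ → ℕ → ℤ × ℤ → Fin 2 → ℕ × Bool), let Φ := fun k j => Fam k j (V k j) (E k j) (Q k j) (σ k j) (τ k j) (bd k j) (cV k j) (cE k j); (∀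 k j, 8 ≤ k → (Φ k j).1) → (∃ β₁ : ℝ, ∀ β, β₁ ≤ β → ∃ m : ℝ, 0 < m ∧ ∀ A B : YMSpecies G, ∃ C : ℝ, ∃ K : ℕ, ∀ k, K ≤ k → Sp A (k / 8) → Sp B (k / 8) → ∃ j₀ : ℕ, ∀ j, j₀ ≤ j → (Φ k j).2 β m C A B) → ∃ β₀ : ℝ, ∀ β, β₀ ≤ β → ∃ m : ℝ, 0 < m ∧ ∃ S₁ : ℕ, ∀ A B : YMSpecies G, ∃ C : ℝ, ∀ S n, S₁ ≤ S → n ≤ S → |latticeConnectedCorr r.ρ β (2 * S + 1) A.F B.F n| ≤ C * Real.exp (-(m * n))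

/-- item stmt-QuantumFields-15828 · crux · rank 5 · open · by operator
why it might fail: Contains the joint continuum limit of all gauge-invariant fields with O(4) invariance (E1) and non-Gaussianity of tr F², both open; a lattice gap m(β)→0 gives a continuum gap only if 1/m(β_k) is THE correlation length of every species, with constants uniform in k.
sources: JaffeWitten2000, Balaban1989, arXiv:1803.01950, OsterwalderSeiler1978, Literature.Barriers.QuantumFields.UVStabilityNonUniqueness
[crux] (existence leg, RE-TYPED for the 2026-08-16 Statement) for every compact simple Lie group G:
IF for every faithful unitary r the volume-uniform weak-coupling lattice gap holds
(UniformLatticeGap body for G, Borel σ-algebra), THEN there are r, a sequential scheme sch WITH β_k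
→ ∞ (`sch.HasWeakCouplingLimit`) and OS data T with IsYangMillsFor r sch T, T non-trivial and
non-Gaussian in tr F², and Δ > 0 with T.HasMassGap Δ ∧ HasLatticeMassGap r sch Δ. Intended use: a_k
∝ m(β_k) with β_k → ∞ (ξ(β) → ∞ is 2001-refereed and hub-filed: DirichletWindow /
XiCompleteMonotonicity), joint continuum limit with E0–E4 at that scale (Bałaban UV control, E1 by
any of the hub's rotation routes), non-triviality from the curvature three/four-point function.
[deps: UniformLatticeGap] [difficulty: open-problem] -/
@[route_item "route-QuantumFields-HyperbolicRegulator"]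
def ContinuumLegGivenGap : Prop :=
  ∀ (G : Type) [Group G] [TopologicalSpace G] [IsTopologicalGroup G] [CompactSpace G], Literature.MathematicalPhysics.QuantumFieldTheory.IsCompactSimpleLieGroup G → letI : MeasurableSpace G := borel G; haveI : BorelSpace G := ⟨rfl⟩; (∀ r : Literature.MathematicalPhysics.QuantumFieldTheory.LatticeRep G, ∃ β₀ : ℝ, ∀ β : ℝ, β₀ ≤ β → ∃ m : ℝ, 0 < m ∧ ∃ S₁ : ℕ, ∀ A B : Literature.MathematicalPhysics.QuantumFieldTheory.YMSpecies G, ∃ C : ℝ, ∀ S n : ℕ, S₁ ≤ S → n ≤ S → |Literature.MathematicalPhysics.QuantumFieldTheory.latticeConnectedCorr r.ρ β (2 * S + 1) A.F B.F n| ≤ C * Real.exp (-(m * n))) → ∃ (r : Literature.MathematicalPhysics.QuantumFieldTheory.LatticeRep G) (sch : Literature.MathematicalPhysics.QuantumFieldTheory.SpeciesScheme (Literature.MathematicalPhysics.QuantumFieldTheory.YMSpecies G)) (T : Literature.MathematicalPhysics.QuantumFieldTheory.OSData (Literature.MathematicalPhysics.QuantumFieldTheory.YMSpecies G) 4), sch.HasWeakCouplingLimit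 ∧ Literature.MathematicalPhysics.QuantumFieldTheory.IsYangMillsFor r sch T ∧ T.IsNontrivial r.curvature ∧ T.IsNonGaussian r.curvature ∧ ∃ Δ > 0, T.HasMassGap Δ ∧ Literature.MathematicalPhysics.QuantumFieldTheory.HasLatticeMassGap r sch Δ

-- earlier Assembly (stmt-QuantumFields-15829, replaced 2026-08-17T13:28:19Z -> stmt-QuantumFields-18176): retired by None — CurvatureAnchor → CurvatureUniformity → HyperbolicToTorus → ContinuumLegGivenGap → YangMills
/-- item stmt-QuantumFields-18176 · assembly · rank 1 · closed · proved by Summit.QuantumFields.YangMills.Theorems.hyperbolicRegulator_assembly_proof (prover) · by planner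
sources: JaffeWitten2000, arXiv:1210.5195
[assembly] CurvatureAnchorR → CurvatureUniformityR → HyperbolicToTorusR → ContinuumLegGivenGap →
YangMills — literally the deciding theorem `closes` (rev 3). Restated 2026-08-17 with the lockstep
Fam repair: the pre-repair chain `CurvatureAnchor → CurvatureUniformity → HyperbolicToTorus →
ContinuumLegGivenGap → YangMills` became ex-falso-true when CurvatureAnchor was refuted
(Theorems.not_CurvatureAnchor) and is retired with it. -/
@[route_item "route-QuantumFields-HyperbolicRegulator"]
def Assembly : Prop :=
  CurvatureAnchorR → CurvatureUniformityR → HyperbolicToTorusR → ContinuumLegGivenGap → YangMills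

-- `Assembly` holds: proved by `Summit.QuantumFields.YangMills.Theorems.hyperbolicRegulator_assembly_proof` (its module imports this route file, so no `_holds` link can be stated here).

-- records of items no longer active in this route (dropped / restated):
-- earlier CurvatureAnchor (stmt-QuantumFields-15826, dropped 2026-08-17T13:28:19Z): refuted by Summit.QuantumFields.YangMills.Theorems.not_CurvatureAnchor @ 7e78b7a32379 — open Literature.MathematicalPhysics.QuantumFieldTheory Literature.MathematicalPhysics.QuantumLattice MeasureTheory in ∀ (G : Type) [Group G] [TopologicalSpace G] [IsTopologicalGroup G] [CompactSpace G], IsCompactSimpleLieGroup G →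

/-! D-0027 §2.1 — DECIDING THEOREM (planner-authored via `route open/edit --closes-file`; by planner-rfix-QuantumFields-HyperbolicRegulat-7847a2fe-0 2026-08-17T13:21:28Z):
its hypotheses are this route's items and its conclusion the sub-problem Statement (glue_lint), and it elaborates with this file. -/

@[closes "route-QuantumFields-HyperbolicRegulator"] theorem closes (h₁ : CurvatureAnchorR) (h₂ : CurvatureUniformityR) (h₃ : HyperbolicToTorusR)
    (h₄ : ContinuumLegGivenGap) : YangMills := by
  intro G _ _ _ _ hG
  refine h₄ G hG fun r => ?_
  obtain ⟨V, E, Q, σ, τ, bd, cV, cE, hAdm, hAnch⟩ := h₁ G hG r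
  exact h₃ G hG r V E Q σ τ bd cV cE hAdm (h₂ G hG r V E Q σ τ bd cV cE hAdm hAnch)

end Summit.QuantumFields.YangMills.Theses.HyperbolicRegulator
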